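import Summits.AnomalousDissipation.AnomalousDissipation.Theorems.ScalarAnomalySteadySourceFormal.Negative.ShearLimit
import Summits.AnomalousDissipation.AnomalousDissipation.Theorems.ScalarAnomalySteadySourceFormal.Negative.DriftDissipation

/-!
# Negative knowledge for the crux `ScalarAnomalySteadySourceFormal` (stmt-AnomalousDissipation-0448), VII-f:
# the total dissipation of a shear–drift-stirred weak solution over `(0,T)`

Certified copy of §9.6 of the cdisprove work file.  From the band inequality of
`Negative.ShearLimit` for `box K' K₂' \\ box K K₂`: (i) the outer layer term is removed by a
pigeonhole over `K' ∈ [N, 2N)` (each mode lies in at most `2R` layers, `sum_Ico_layerSum_le`) and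
`N → ∞`; (ii) `K₂' → ∞` exhausts the complement of the inner box; (iii) the inner box dissipates at
most `4π²(K²+K₂²) ∫ ‖θ‖²`.  Since `∫⁻ ‖∇θ‖² = sup` over finite mode sets (`lintegral_grad_eq_iSup`),
this gives the **per-`T` dissipation inequality** (`perT_dissipation_le`):
`2ν ∫⁻_{(0,T)} ‖∇θ(t)‖² ≤ ‖θ₀‖² + 8π²ν(K²+K₂²) ∫‖θ‖² + 4π #S M K₂ ∫ layerSum_K + 2 η_out ∫ ‖θ‖` —
in particular the dissipation integral is FINITE for every weak solution of the class.

Supports stmt-AnomalousDissipation-0448 (the shear–drift no-go, files `Shear*`).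
-/

set_option linter.dupNamespace false

noncomputable section

open scoped BigOperators Topology ENNReal NNReal InnerProductSpace ContDiff
open Filter Set Function MeasureTheory UnitAddTorus Complex

namespace Summit.AnomalousDissipation.AnomalousDissipation.Theorems.ScalarAnomalySteadySourceFormal.Negative

open Literature.Analysis
open Literature.Analysis.FunctionSpaces Literature.Analysis.FunctionSpaces.Torus
open Literature.Analysis.FluidPDE Literature.Analysis.FluidPDE.Torus

/-- The frequency lattice `ℤ²` (local notation). -/
local notation "ℤ²" => Fin 2 → ℤ

section Counting

/-- **Each mode lies in at most `2R` consecutive layers**: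
`∑_{K∈[a,a+N)} layerSum (K-R) (K+R) b Y ≤ 2R ∑_{p ∈ box (a+N+R) b} ‖Y p‖²`. [folklore] -/
theorem sum_Ico_layerSum_le (R : ℕ) (a b : ℤ) (N : ℕ) (Y : ℤ² → ℂ) :
    ∑ K ∈ Finset.Ico a (a + N), layerSum (K - R) (K + R) b Y ≤ 2 * R * ∑ p ∈ box (a + N + R) b, ‖Y p‖ ^ 2 := by
  classical
  set U := box (a + N + R) b with hU
  have hsub : ∀ K ∈ Finset.Ico a (a + N), layer (K - R) (K + R) b ⊆ U := by
    intro K hK p hp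
    rw [Finset.mem_Ico] at hK
    rw [mem_layer] at hp
    rw [hU, mem_box]
    exact ⟨by omega, hp.2⟩
  have e1 : ∀ K ∈ Finset.Ico a (a + N), layerSum (K - R) (K + R) b Y =
      ∑ p ∈ U, if p ∈ layer (K - R) (K + R) b then ‖Y p‖ ^ 2 else 0 := by
    intro K hK
    rw [layerSum, ← Finset.sum_filter]
    congr 1
    ext p
    simp only [Finset.mem_filter]
    exact ⟨fun hp => ⟨hsub K hK hp, hp⟩, fun hp => hp.2⟩
  rw [Finset.sum_congr rfl e1, Finset.sum_comm, Finset.mul_sum]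
  refine Finset.sum_le_sum fun p _ => ?_
  rw [← Finset.sum_filter, Finset.sum_const, nsmul_eq_mul]
  refine mul_le_mul_of_nonneg_right ?_ (sq_nonneg _)
  have hcard : ((Finset.Ico a (a + N)).filter fun K => p ∈ layer (K - R) (K + R) b) ⊆
      Finset.Ico (|p 0| - R) (|p 0| + R) := by
    intro K hK
    simp only [Finset.mem_filter, mem_layer, Finset.mem_Ico] at hK ⊢
    omega
  calc (((Finset.Ico a (a + N)).filter fun K => p ∈ layer (K - R) (K + R) b).card : ℝ)
      ≤ (Finset.Ico (|p 0| - R) (|p 0| + R)).card := by exact_mod_cast Finset.card_le_card hcard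
    _ = 2 * R := by
        rw [Int.card_Ico]
        have : |p 0| + R - (|p 0| - R) = 2 * R := by ring
        rw [this]
        norm_cast

end Counting

section Total

variable {ν : ℝ} {S : Finset ℤ²} {R : ℕ} {M : ℝ} {c : ℝ → ℤ² → EuclideanSpace ℂ (Fin 2)}
  {u : ℝ → UnitAddTorus (Fin 2) → EuclideanSpace ℝ (Fin 2)} {h θ₀ : UnitAddTorus (Fin 2) → ℝ}
  {θ : ℝ → UnitAddTorus (Fin 2) → ℝ}

/-- The time-integrated modal energies `q_p = ∫_{(0,T)} ‖y_p(t)‖² dt`. [folklore] -/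
def modeEnergyInt (θ : ℝ → UnitAddTorus (Fin 2) → ℝ) (T : ℝ) (p : ℤ²) : ℝ :=
  ∫ t in Ioo 0 T, ‖modes θ t p‖ ^ 2

/-- `q_p ≥ 0`. [folklore] -/
theorem modeEnergyInt_nonneg (θ : ℝ → UnitAddTorus (Fin 2) → ℝ) (T : ℝ) (p : ℤ²) : 0 ≤ modeEnergyInt θ T p :=
  setIntegral_nonneg measurableSet_Ioo fun _ _ => sq_nonneg _

/-- **Layer pigeonhole**: among `N ≥ 1` consecutive layers `K ∈ [a, a+N)` one carries at most
`2R ∫‖θ‖² / N` (time-integrated). [folklore] -/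
theorem exists_layer_small (hw : IsWeakScalarTransportForced ν u (fun _ => h) θ₀ θ) {T : ℝ} (hT : 0 < T)
    (a b : ℤ) {N : ℕ} (hN : 1 ≤ N) :
    ∃ K' ∈ Finset.Ico a (a + N), ∫ t in Ioo 0 T, layerSum (K' - R) (K' + R) b (modes θ t) ≤
      2 * R * (∫ t in Ioo 0 T, scalarL2Sq (θ t)) / N := by
  classical
  have hwT := hw T hT
  set I := Finset.Ico a (a + N) with hI
  have hIcard : I.card = N := by rw [hI, Int.card_Ico]; omega
  have hIne : I.Nonempty := by rw [← Finset.card_pos, hIcard]; omega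
  have hint : ∀ K' ∈ I, IntegrableOn (fun t => layerSum (K' - R) (K' + R) b (modes θ t)) (Ioo 0 T) volume := by
    intro K' _
    simpa [layerSum] using forced_integrableOn_sum_sq_modes hwT (layer (K' - R) (K' + R) b) (fun _ => 1)
  have hsum : ∑ K' ∈ I, ∫ t in Ioo 0 T, layerSum (K' - R) (K' + R) b (modes θ t) ≤
      2 * R * ∫ t in Ioo 0 T, scalarL2Sq (θ t) := by
    rw [← integral_finsetSum _ hint, ← integral_const_mul]
    refine integral_mono_ae (integrable_finsetSum _ hint) ((forced_integrableOn_scalarL2Sq hwT).const_mul _) ?_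
    filter_upwards [forced_ae_sum_sq_modes_le hwT (box (a + N + R) b)] with t ht
    have h1 := sum_Ico_layerSum_le R a b N (modes θ t)
    calc ∑ K' ∈ I, layerSum (K' - R) (K' + R) b (modes θ t)
        ≤ 2 * R * ∑ p ∈ box (a + N + R) b, ‖modes θ t p‖ ^ 2 := h1
      _ ≤ 2 * R * scalarL2Sq (θ t) := by gcongr
  have hsum' : ∑ K' ∈ I, ∫ t in Ioo 0 T, layerSum (K' - R) (K' + R) b (modes θ t) ≤
      ∑ K' ∈ I, 2 * R * (∫ t in Ioo 0 T, scalarL2Sq (θ t)) / N := by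
    rw [Finset.sum_const, hIcard, nsmul_eq_mul]
    have hNpos : (0 : ℝ) < N := by exact_mod_cast hN
    calc _ ≤ 2 * R * ∫ t in Ioo 0 T, scalarL2Sq (θ t) := hsum
      _ = N * (2 * R * (∫ t in Ioo 0 T, scalarL2Sq (θ t)) / N) := by field_simp
  exact Finset.exists_le_of_sum_le hIne hsum'

/-- The `ℓ²` mass of the source modes OUTSIDE a box: `η_out(K,K₂) = (∑_{p ∉ box K K₂} ‖𝓕h(p)‖²)^{1/2}`. [folklore] -/
def sourceTailMass (K K₂ : ℤ) (h : UnitAddTorus (Fin 2) → ℝ) : ℝ :=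
  Real.sqrt (∑' p : ℤ², if p ∈ box K K₂ then 0 else ‖mFourierCoeff (fun x => (h x : ℂ)) p‖ ^ 2)

/-- `sourceTailMass ≥ 0`. [folklore] -/
theorem sourceTailMass_nonneg (K K₂ : ℤ) (h : UnitAddTorus (Fin 2) → ℝ) : 0 ≤ sourceTailMass K K₂ h :=
  Real.sqrt_nonneg _

/-- The source mass of a band outside `box K K₂` is at most the tail mass. [folklore] -/
theorem sourceMass_le_sourceTailMass {K K₂ : ℤ} (hh : MemLp h 2 volume) {𝔅 : Finset ℤ²} (h𝔅 : ∀ p ∈ 𝔅, p ∉ box K K₂) :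
    sourceMass 𝔅 h ≤ sourceTailMass K K₂ h := by
  classical
  unfold sourceMass sourceTailMass
  refine Real.sqrt_le_sqrt ?_
  have hsum : Summable fun p : ℤ² => if p ∈ box K K₂ then (0 : ℝ) else ‖mFourierCoeff (fun x => (h x : ℂ)) p‖ ^ 2 := by
    refine Summable.of_nonneg_of_le (fun p => by split_ifs <;> positivity) (fun p => ?_)
      (FunctionSpaces.Torus.hasSum_sq_norm_mFourierCoeff_ofReal hh).summable
    split_ifs
    exacts [sq_nonneg _, le_rfl]
  calc ∑ p ∈ 𝔅, ‖mFourierCoeff (fun x => (h x : ℂ)) p‖ ^ 2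
      = ∑ p ∈ 𝔅, (if p ∈ box K K₂ then (0 : ℝ) else ‖mFourierCoeff (fun x => (h x : ℂ)) p‖ ^ 2) :=
        Finset.sum_congr rfl fun p hp => by rw [if_neg (h𝔅 p hp)]
    _ ≤ _ := sum_le_hasSum 𝔅 (fun p _ => by split_ifs <;> positivity) hsum.hasSum

/-- **Finite sums of complement modes**: for every finite `F` outside `box K K₂`,
`2ν ∑_{p∈F} 4π²|p|² q_p ≤ ‖θ₀‖² + 4π #S M K₂ ∫ layerSum_K + 2 η_out ∫ ‖θ‖`. [folklore] -/
theorem compl_finset_dissipation_le (hw : IsWeakScalarTransportForced ν u (fun _ => h) θ₀ θ) (hν : 0 ≤ ν)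
    (hu : ∀ s, u s = realTrigPoly S (c s)) (hh : MemLp h 2 volume) (hθ₀ : MemLp θ₀ 2 volume)
    (hc : ∀ k, Continuous fun s => c s k) (hM : ∀ s k, ‖c s k‖ ≤ M) (hM0 : 0 ≤ M)
    (htrans : ∀ s, ∀ k ∈ S, zdot k (c s k) = 0) (hS : ∀ k ∈ S, k 1 = 0 ∧ |k 0| ≤ R)
    {K K₂ : ℤ} (hK₂ : 0 ≤ K₂) {T : ℝ} (hT : 0 < T) {F : Finset ℤ²} (hF : ∀ p ∈ F, p ∉ box K K₂) :
    2 * ν * ∑ p ∈ F, 4 * Real.pi ^ 2 * freqNormSq p * modeEnergyInt θ T p ≤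
      scalarL2Sq θ₀ + 4 * Real.pi * S.card * M * K₂ * (∫ t in Ioo 0 T, layerSum (K - R) (K + R) K₂ (modes θ t)) +
        2 * sourceTailMass K K₂ h * ∫ t in Ioo 0 T, Real.sqrt (scalarL2Sq (θ t)) := by
  classical
  have hhi : Integrable h volume := hh.integrable one_le_two
  set V : ℝ := ∫ t in Ioo 0 T, scalarL2Sq (θ t) with hV
  set G : ℝ := ∫ t in Ioo 0 T, layerSum (K - R) (K + R) K₂ (modes θ t) with hG
  set W : ℝ := ∫ t in Ioo 0 T, Real.sqrt (scalarL2Sq (θ t)) with hW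
  set C₀ : ℝ := scalarL2Sq θ₀ + 4 * Real.pi * S.card * M * K₂ * G + 2 * sourceTailMass K K₂ h * W with hC₀
  have hV0 : 0 ≤ V := setIntegral_nonneg measurableSet_Ioo fun _ _ => scalarL2Sq_nonneg _
  have hW0 : 0 ≤ W := setIntegral_nonneg measurableSet_Ioo fun _ _ => Real.sqrt_nonneg _
  -- a box containing F
  obtain ⟨L, hL⟩ : ∃ L : ℕ, ∀ p ∈ F, |p 0| ≤ L ∧ |p 1| ≤ L := by
    refine ⟨F.sup fun p => (|p 0|).toNat + (|p 1|).toNat, fun p hp => ?_⟩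
    have h1 : (|p 0|).toNat + (|p 1|).toNat ≤ F.sup fun p => (|p 0|).toNat + (|p 1|).toNat :=
      Finset.le_sup (f := fun p : ℤ² => (|p 0|).toNat + (|p 1|).toNat) hp
    constructor <;> omega
  -- main estimate for every `N ≥ max L 1` with `K₂' := max K₂ L`
  set K₂' : ℤ := max K₂ L with hK₂'
  have hK₂'0 : 0 ≤ K₂' := le_max_of_le_left hK₂
  have key : ∀ N : ℕ, 1 ≤ N → (L : ℤ) ≤ N → K ≤ N →
      2 * ν * ∑ p ∈ F, 4 * Real.pi ^ 2 * freqNormSq p * modeEnergyInt θ T p ≤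
        C₀ + 4 * Real.pi * S.card * M * K₂' * (2 * R * V / N) := by
    intro N hN1 hNL hNK
    obtain ⟨K', hK'I, hK'⟩ := exists_layer_small (R := R) hw hT (N : ℤ) K₂' hN1
    rw [Finset.mem_Ico] at hK'I
    have hband := band_modes_le hw hu hhi hθ₀ hc hM hM0 htrans hS (K := K) (K' := K') hK₂ hK₂'0 hT
    rw [integral_bandDiss_eq hw hT] at hband
    -- F ⊆ the band
    have hFsub : F ⊆ box K' K₂' \ box K K₂ := by
      intro p hp
      rw [Finset.mem_sdiff, mem_box]
      refine ⟨⟨?_, ?_⟩, hF p hp⟩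
      · have := (hL p hp).1; omega
      · have := (hL p hp).2
        exact this.trans (le_max_right _ _)
    have hmono : ∑ p ∈ F, 4 * Real.pi ^ 2 * freqNormSq p * modeEnergyInt θ T p ≤
        ∑ p ∈ box K' K₂' \ box K K₂, 4 * Real.pi ^ 2 * freqNormSq p * ∫ t in Ioo 0 T, ‖modes θ t p‖ ^ 2 :=
      Finset.sum_le_sum_of_subset_of_nonneg hFsub fun p _ _ => by
        have := freqNormSq_nonneg p; have := modeEnergyInt_nonneg θ T p
        unfold modeEnergyInt at this; positivity
    have hsm := sourceMass_le_sourceTailMass hh (𝔅 := box K' K₂' \ box K K₂) fun p hp => (Finset.mem_sdiff.1 hp).2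
    have hπ := Real.pi_pos
    have hG0 : 0 ≤ G := setIntegral_nonneg measurableSet_Ioo fun _ _ => layerSum_nonneg _ _ _ _
    calc 2 * ν * ∑ p ∈ F, 4 * Real.pi ^ 2 * freqNormSq p * modeEnergyInt θ T p
        ≤ 2 * ν * ∑ p ∈ box K' K₂' \ box K K₂, 4 * Real.pi ^ 2 * freqNormSq p * ∫ t in Ioo 0 T, ‖modes θ t p‖ ^ 2 := by
          gcongr
      _ ≤ scalarL2Sq θ₀ + 4 * Real.pi * S.card * M * (K₂ * G +
            K₂' * ∫ t in Ioo 0 T, layerSum (K' - R) (K' + R) K₂' (modes θ t)) +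
          2 * sourceMass (box K' K₂' \ box K K₂) h * W := hband
      _ ≤ scalarL2Sq θ₀ + 4 * Real.pi * S.card * M * (K₂ * G + K₂' * (2 * R * V / N)) +
          2 * sourceTailMass K K₂ h * W := by
          gcongr
      _ = C₀ + 4 * Real.pi * S.card * M * K₂' * (2 * R * V / N) := by rw [hC₀]; ring
  -- let `N → ∞`
  refine le_of_forall_pos_le_add fun ε hε => ?_
  set A : ℝ := 4 * Real.pi * S.card * M * K₂' * (2 * R * V) with hA
  have hA0 : 0 ≤ A := by have := Real.pi_pos; positivity
  obtain ⟨N, hN⟩ := exists_nat_gt (max (max (L : ℝ) (K : ℝ)) (max 1 (A / ε)))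
  have hN1 : (1 : ℝ) < N := lt_of_le_of_lt ((le_max_left _ _).trans (le_max_right _ _)) hN
  have hN1' : 1 ≤ N := by exact_mod_cast hN1.le
  have hNL : (L : ℤ) ≤ N := by
    have : (L : ℝ) < N := lt_of_le_of_lt ((le_max_left _ _).trans (le_max_left _ _)) hN
    exact_mod_cast this.le
  have hNK : K ≤ N := by
    have : (K : ℝ) < N := lt_of_le_of_lt ((le_max_right _ _).trans (le_max_left _ _)) hN
    exact_mod_cast this.le
  have hAN : A / N ≤ ε := by
    have hNpos : (0 : ℝ) < N := by linarith
    rw [div_le_iff₀ hNpos]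
    have : A / ε < N := lt_of_le_of_lt ((le_max_right _ _).trans (le_max_right _ _)) hN
    rw [div_lt_iff₀ hε] at this
    linarith
  calc _ ≤ C₀ + 4 * Real.pi * S.card * M * K₂' * (2 * R * V / N) := key N hN1' hNL hNK
    _ = C₀ + A / N := by rw [hA]; ring
    _ ≤ C₀ + ε := by linarith

/-- **Inner box**: `∑_{p ∈ box K K₂} 4π²|p|² q_p ≤ 4π²(K²+K₂²) ∫‖θ‖²`. [folklore] -/
theorem box_dissipation_le (hw : IsWeakScalarTransportForced ν u (fun _ => h) θ₀ θ) {K K₂ : ℤ} {T : ℝ} (hT : 0 < T) :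
    ∑ p ∈ box K K₂, 4 * Real.pi ^ 2 * freqNormSq p * modeEnergyInt θ T p ≤
      4 * Real.pi ^ 2 * (K ^ 2 + K₂ ^ 2) * ∫ t in Ioo 0 T, scalarL2Sq (θ t) := by
  classical
  have hwT := hw T hT
  have hf : ∀ p ∈ box K K₂, freqNormSq p ≤ (K : ℝ) ^ 2 + (K₂ : ℝ) ^ 2 := by
    intro p hp
    rw [mem_box] at hp
    rw [freqNormSq, Fin.sum_univ_two]
    have h0 : ((p 0 : ℤ) : ℝ) ^ 2 ≤ (K : ℝ) ^ 2 := by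
      have : |((p 0 : ℤ) : ℝ)| ≤ |(K : ℝ)| := by
        rw [abs_of_nonneg (show (0:ℝ) ≤ K by exact_mod_cast (abs_nonneg _).trans hp.1)]; exact_mod_cast hp.1
      exact sq_le_sq.2 this
    have h1 : ((p 1 : ℤ) : ℝ) ^ 2 ≤ (K₂ : ℝ) ^ 2 := by
      have : |((p 1 : ℤ) : ℝ)| ≤ |(K₂ : ℝ)| := by
        rw [abs_of_nonneg (show (0:ℝ) ≤ K₂ by exact_mod_cast (abs_nonneg _).trans hp.2)]; exact_mod_cast hp.2
      exact sq_le_sq.2 this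
    linarith
  calc ∑ p ∈ box K K₂, 4 * Real.pi ^ 2 * freqNormSq p * modeEnergyInt θ T p
      ≤ ∑ p ∈ box K K₂, 4 * Real.pi ^ 2 * ((K : ℝ) ^ 2 + (K₂ : ℝ) ^ 2) * modeEnergyInt θ T p := by
        refine Finset.sum_le_sum fun p hp => ?_
        have := modeEnergyInt_nonneg θ T p
        gcongr
        exact hf p hp
    _ = 4 * Real.pi ^ 2 * ((K : ℝ) ^ 2 + (K₂ : ℝ) ^ 2) * ∫ t in Ioo 0 T, ∑ p ∈ box K K₂, ‖modes θ t p‖ ^ 2 := by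
        rw [← Finset.mul_sum, integral_finsetSum _ fun p _ => forced_integrableOn_sq_modes hwT p]
        rfl
    _ ≤ 4 * Real.pi ^ 2 * ((K : ℝ) ^ 2 + (K₂ : ℝ) ^ 2) * ∫ t in Ioo 0 T, scalarL2Sq (θ t) := by
        refine mul_le_mul_of_nonneg_left (integral_mono_ae
          (integrable_finsetSum _ fun p _ => forced_integrableOn_sq_modes hwT p)
          (forced_integrableOn_scalarL2Sq hwT) (forced_ae_sum_sq_modes_le hwT _)) (by positivity)

/-- **Every finite set of modes**: `2ν ∑_{p∈F} 4π²|p|² q_p ≤ RHS(K, K₂, T)`. [folklore] -/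
theorem finset_dissipation_le (hw : IsWeakScalarTransportForced ν u (fun _ => h) θ₀ θ) (hν : 0 ≤ ν)
    (hu : ∀ s, u s = realTrigPoly S (c s)) (hh : MemLp h 2 volume) (hθ₀ : MemLp θ₀ 2 volume)
    (hc : ∀ k, Continuous fun s => c s k) (hM : ∀ s k, ‖c s k‖ ≤ M) (hM0 : 0 ≤ M)
    (htrans : ∀ s, ∀ k ∈ S, zdot k (c s k) = 0) (hS : ∀ k ∈ S, k 1 = 0 ∧ |k 0| ≤ R)
    {K K₂ : ℤ} (hK₂ : 0 ≤ K₂) {T : ℝ} (hT : 0 < T) (F : Finset ℤ²) :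
    2 * ν * ∑ p ∈ F, 4 * Real.pi ^ 2 * freqNormSq p * modeEnergyInt θ T p ≤
      scalarL2Sq θ₀ + 8 * Real.pi ^ 2 * ν * (K ^ 2 + K₂ ^ 2) * (∫ t in Ioo 0 T, scalarL2Sq (θ t)) +
        4 * Real.pi * S.card * M * K₂ * (∫ t in Ioo 0 T, layerSum (K - R) (K + R) K₂ (modes θ t)) +
        2 * sourceTailMass K K₂ h * ∫ t in Ioo 0 T, Real.sqrt (scalarL2Sq (θ t)) := by
  classical
  have hsplit : ∑ p ∈ F, 4 * Real.pi ^ 2 * freqNormSq p * modeEnergyInt θ T p =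
      ∑ p ∈ F.filter (fun p => p ∈ box K K₂), 4 * Real.pi ^ 2 * freqNormSq p * modeEnergyInt θ T p +
      ∑ p ∈ F.filter (fun p => p ∉ box K K₂), 4 * Real.pi ^ 2 * freqNormSq p * modeEnergyInt θ T p :=
    (Finset.sum_filter_add_sum_filter_not F (fun p => p ∈ box K K₂) _).symm
  have hin : ∑ p ∈ F.filter (fun p => p ∈ box K K₂), 4 * Real.pi ^ 2 * freqNormSq p * modeEnergyInt θ T p ≤
      4 * Real.pi ^ 2 * (K ^ 2 + K₂ ^ 2) * ∫ t in Ioo 0 T, scalarL2Sq (θ t) := by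
    refine le_trans ?_ (box_dissipation_le hw hT)
    refine Finset.sum_le_sum_of_subset_of_nonneg (fun p hp => (Finset.mem_filter.1 hp).2) fun p _ _ => ?_
    have := freqNormSq_nonneg p; have := modeEnergyInt_nonneg θ T p; positivity
  have hout := compl_finset_dissipation_le hw hν hu hh hθ₀ hc hM hM0 htrans hS hK₂ hT
    (F := F.filter (fun p => p ∉ box K K₂)) fun p hp => (Finset.mem_filter.1 hp).2
  rw [hsplit, mul_add]
  nlinarith [hin, hout, hν]

/-- **The dissipation integral as a supremum over finite mode sets**:
`∫⁻_{(0,T)} ‖∇θ(t)‖² = ⨆_F ofReal (∑_{p∈F} 4π²|p|² q_p)`. [folklore] -/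
theorem lintegral_grad_eq_iSup (hw : IsWeakScalarTransportForced ν u (fun _ => h) θ₀ θ) {T : ℝ} (hT : 0 < T) :
    ∫⁻ t in Ioo 0 T, eScalarGradNormSq (θ t) =
      ⨆ F : Finset ℤ², ENNReal.ofReal (∑ p ∈ F, 4 * Real.pi ^ 2 * freqNormSq p * modeEnergyInt θ T p) := by
  classical
  have hwT := hw T hT
  have hmeas : ∀ p : ℤ², AEMeasurable (fun t => ENNReal.ofReal (freqNormSq p) * ‖modes θ t p‖ₑ ^ 2)
      (volume.restrict (Ioo 0 T)) := fun p =>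
    (((forced_integrableOn_mFourierCoeff hwT p).aestronglyMeasurable.aemeasurable.enorm.pow_const 2).const_mul _)
  have e1 : ∫⁻ t in Ioo 0 T, eScalarGradNormSq (θ t) =
      ENNReal.ofReal (4 * Real.pi ^ 2) * ∑' p : ℤ², ENNReal.ofReal (freqNormSq p) * ∫⁻ t in Ioo 0 T, ‖modes θ t p‖ₑ ^ 2 := by
    have hpt : ∀ t, eScalarGradNormSq (θ t) =
        ENNReal.ofReal (4 * Real.pi ^ 2) * ∑' p : ℤ², ENNReal.ofReal (freqNormSq p) * ‖modes θ t p‖ₑ ^ 2 :=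
      fun t => eScalarGradNormSq_eq_tsum (θ t)
    simp_rw [hpt]
    rw [lintegral_const_mul' _ _ ENNReal.ofReal_ne_top, lintegral_tsum hmeas]
    congr 1
    refine tsum_congr fun p => ?_
    rw [lintegral_const_mul' _ _ ENNReal.ofReal_ne_top]
  have e2 : ∀ p : ℤ², ∫⁻ t in Ioo 0 T, ‖modes θ t p‖ₑ ^ 2 = ENNReal.ofReal (modeEnergyInt θ T p) := by
    intro p
    rw [modeEnergyInt, ofReal_integral_eq_lintegral_ofReal (forced_integrableOn_sq_modes hwT p)
      (Eventually.of_forall fun t => sq_nonneg _)]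
    refine lintegral_congr fun t => ?_
    rw [← ofReal_norm, ENNReal.ofReal_pow (norm_nonneg _)]
  simp_rw [e2] at e1
  rw [e1, ENNReal.tsum_eq_iSup_sum, ENNReal.mul_iSup]
  refine iSup_congr fun F => ?_
  rw [ENNReal.ofReal_sum_of_nonneg fun p _ => ?_, Finset.mul_sum]
  · refine Finset.sum_congr rfl fun p _ => ?_
    have := freqNormSq_nonneg p; have := modeEnergyInt_nonneg θ T p
    rw [← ENNReal.ofReal_mul (by positivity), ← ENNReal.ofReal_mul (by positivity)]
    congr 1; ring
  · have := freqNormSq_nonneg p; have := modeEnergyInt_nonneg θ T p; positivity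

/-- **Per-`T` dissipation inequality** for a weak solution stirred by a shear–drift field:
`2ν ∫⁻_{(0,T)} ‖∇θ(t)‖² ≤ ofReal (‖θ₀‖² + 8π²ν(K²+K₂²) ∫‖θ‖² + 4π #S M K₂ ∫ layerSum_K + 2 η_out ∫‖θ‖)`
for every `T > 0` and all cut-offs `K, K₂ ≥ 0`; in particular the dissipation integral is finite. [folklore] -/
theorem perT_dissipation_le (hw : IsWeakScalarTransportForced ν u (fun _ => h) θ₀ θ) (hν : 0 ≤ ν)
    (hu : ∀ s, u s = realTrigPoly S (c s)) (hh : MemLp h 2 volume) (hθ₀ : MemLp θ₀ 2 volume)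
    (hc : ∀ k, Continuous fun s => c s k) (hM : ∀ s k, ‖c s k‖ ≤ M) (hM0 : 0 ≤ M)
    (htrans : ∀ s, ∀ k ∈ S, zdot k (c s k) = 0) (hS : ∀ k ∈ S, k 1 = 0 ∧ |k 0| ≤ R)
    {K K₂ : ℤ} (hK₂ : 0 ≤ K₂) {T : ℝ} (hT : 0 < T) :
    ENNReal.ofReal (2 * ν) * ∫⁻ t in Ioo 0 T, eScalarGradNormSq (θ t) ≤
      ENNReal.ofReal (scalarL2Sq θ₀ + 8 * Real.pi ^ 2 * ν * (K ^ 2 + K₂ ^ 2) * (∫ t in Ioo 0 T, scalarL2Sq (θ t)) +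
        4 * Real.pi * S.card * M * K₂ * (∫ t in Ioo 0 T, layerSum (K - R) (K + R) K₂ (modes θ t)) +
        2 * sourceTailMass K K₂ h * ∫ t in Ioo 0 T, Real.sqrt (scalarL2Sq (θ t))) := by
  rw [lintegral_grad_eq_iSup hw hT, ENNReal.mul_iSup]
  refine iSup_le fun F => ?_
  rw [← ENNReal.ofReal_mul (by positivity)]
  exact ENNReal.ofReal_le_ofReal (finset_dissipation_le hw hν hu hh hθ₀ hc hM hM0 htrans hS hK₂ hT F)

end Total

end Summit.AnomalousDissipation.AnomalousDissipation.Theorems.ScalarAnomalySteadySourceFormal.Negative
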